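import Summits.CriticalPhenomena.PercolationContinuityZ3.Theorems.Transplant.FKConnectivityAllQAntipodalPivotSplit
import HarnessLib

/-!
# Connectivity correlation inequalities for `φ_{w,q}`, every `q > 0` — file 77a: **SQUARE CERTIFICATES CLOSE `C_∞⁺`**
# (the two-sided, increasing-differences form of the levelwise antipodal inequality)

Support file (`--supports stmt-CriticalPhenomena-4575`), FK sub-lane `prim-bschramm-fk-2` (gen 35); builds on p205010 (kernel theorem, internal audit
signed; external expert review pending).  No definitions, no named facts, no sorries; standard axioms.

Fix a cell `(M, C)`, a read set `S ⊆ M` for the first test function and a cut-off `J`; write `ℓ = apExpC M C`, `f̂(γ) = f(γ∪C) − f((M∖γ)∪C)`,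
`ĝ` likewise, and `τγ = (S ∖ γ) ∪ (γ ∖ S)` for the configuration with the `S`-part FLIPPED.  For `f` reading only `S` and `g` not reading `S` one has
`f̂(τγ) = −f̂(γ)`, `ĝ(τγ) = ĝ(γ)`, so the levelwise antipodal sum is `Σ_{ℓ(γ)≤J} f̂ĝ = −½ Σ_γ D_J(γ) f̂ĝ(γ)` with the doubly odd kernel
`D_J(γ) = 1{ℓ(τγ) ≤ J} − 1{ℓ(γ) ≤ J}`.  A **square certificate** at level `J` is a nonnegative weight `c(γ, e, e')` (`e ∈ S`, `e' ∈ M ∖ S`) with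
`D_J = Σ c(γ,e,e')·(δ_γ + δ_{γ+e+e'} − δ_{γ+e} − δ_{γ+e'})` — stated below in its functional form (tested against every `Φ`).  Since
`f̂ĝ(γ) + f̂ĝ(γ+e+e') − f̂ĝ(γ+e) − f̂ĝ(γ+e') = (f̂(γ+e) − f̂(γ))(ĝ(γ+e') − ĝ(γ)) ≥ 0` for increasing `f, g`, a square certificate forces
`Σ_{ℓ(γ)≤J} f̂ĝ ≤ 0` for EVERY increasing `f` reading only `S` and EVERY increasing `g` not reading `S` (**`FK.levels_le_of_squareCert`**).
By LP duality a square certificate exists iff `Σ_γ D_J(γ)Φ(γ) ≥ 0` for every `Φ` with increasing differences between the `S`-block and the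
`(M∖S)`-block ('ID-dominance'); this is STRICTLY stronger than the rectangle form of `C_∞⁺` from `|S| = |M∖S| = 3` on, equal to Theorem U's
loser-to-winner matching for `|S| = 1`, and holds in every exact instance examined (memo FROM-fk-2-g35-SQUARE-CERTIFICATES, FK-Q2 §44).
[cite: Grimmett2006, §1.4 eq. (1.20) (p. 15); §3.8 Thm. (3.90) (pp. 61–62)] [cite: Wagner2006, Thm. 5.8(d), §5.3]
-/

noncomputable section

namespace Summit.CriticalPhenomena.PercolationContinuityZ3.Theorems

namespace FK

open SimpleGraph Literature.Probability.LatticeModels Literature.Probability.Percolation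
open scoped Classical

variable {V : Type*}

/-- A function invariant under inserting any pair with property `P` is invariant under adjoining any finite set of such pairs. [folklore] -/
theorem insertInvariant_union {f : Finset (Sym2 V) → ℝ} {P : Sym2 V → Prop}
    (hf : ∀ e : Sym2 V, P e → ∀ A : Finset (Sym2 V), f (insert e A) = f A) :
    ∀ U : Finset (Sym2 V), (∀ e ∈ U, P e) → ∀ B : Finset (Sym2 V), f (B ∪ U) = f B := by
  intro U
  induction U using Finset.induction_on with
  | empty => intro _ B; rw [Finset.union_empty]
  | @insert e U _ ih =>
    intro hU B
    rw [Finset.union_insert, hf e (hU e (Finset.mem_insert_self _ _)), ih (fun e' he' => hU e' (Finset.mem_insert_of_mem he')) B]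

/-- A function reading only the pairs of `S` depends only on the trace on `S`. [folklore] -/
theorem eq_of_readOnly_inter_eq {f : Finset (Sym2 V) → ℝ} {S : Finset (Sym2 V)}
    (hf : ∀ e : Sym2 V, e ∉ S → ∀ A : Finset (Sym2 V), f (insert e A) = f A) {A B : Finset (Sym2 V)}
    (h : A ∩ S = B ∩ S) : f A = f B := by
  have key : ∀ X : Finset (Sym2 V), f X = f (X ∩ S) := by
    intro X
    have h1 : f (X ∩ S ∪ X \ S) = f (X ∩ S) :=
      insertInvariant_union (P := fun e => e ∉ S) hf (X \ S) (fun e he => (Finset.mem_sdiff.1 he).2) (X ∩ S)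
    rwa [Finset.union_comm, Finset.sdiff_union_inter] at h1
  rw [key A, key B, h]

/-- A function not reading the pairs of `S` depends only on the trace off `S`. [folklore] -/
theorem eq_of_notRead_sdiff_eq {g : Finset (Sym2 V) → ℝ} {S : Finset (Sym2 V)}
    (hg : ∀ e ∈ S, ∀ A : Finset (Sym2 V), g (insert e A) = g A) {A B : Finset (Sym2 V)}
    (h : A \ S = B \ S) : g A = g B := by
  have key : ∀ X : Finset (Sym2 V), g X = g (X \ S) := by
    intro X
    have h1 : g (X \ S ∪ X ∩ S) = g (X \ S) :=
      insertInvariant_union (P := fun e => e ∈ S) hg (X ∩ S) (fun e he => (Finset.mem_inter.1 he).2) (X \ S)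
    rwa [Finset.sdiff_union_inter] at h1
  rw [key A, key B, h]

/-- The `S`-flip `γ ↦ (S ∖ γ) ∪ (γ ∖ S)` is an involution on the configurations of `M ⊇ S`. [folklore] -/
theorem sflip_sflip {M S γ : Finset (Sym2 V)} (hS : S ⊆ M) (hγ : γ ⊆ M) :
    (S \ (S \ γ ∪ γ \ S)) ∪ ((S \ γ ∪ γ \ S) \ S) = γ := by
  ext x
  have h1 : x ∈ S → x ∈ M := fun h => hS h
  have h2 : x ∈ γ → x ∈ M := fun h => hγ h
  simp only [Finset.mem_union, Finset.mem_sdiff]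
  tauto

/-- The `S`-flip of a configuration of `M ⊇ S` is a configuration of `M`. [folklore] -/
theorem sflip_subset {M S γ : Finset (Sym2 V)} (hS : S ⊆ M) (hγ : γ ⊆ M) : S \ γ ∪ γ \ S ⊆ M :=
  Finset.union_subset (Finset.sdiff_subset.trans hS) (Finset.sdiff_subset.trans hγ)

/-- Under the `S`-flip the antipodal difference of a function READING ONLY `S` changes sign. [folklore] -/
theorem hat_sflip_of_readOnly {f : Finset (Sym2 V) → ℝ} {M C S γ : Finset (Sym2 V)} (hS : S ⊆ M) (hγ : γ ⊆ M)
    (hf : ∀ e : Sym2 V, e ∉ S → ∀ A : Finset (Sym2 V), f (insert e A) = f A) :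
    f (S \ γ ∪ γ \ S ∪ C) - f (M \ (S \ γ ∪ γ \ S) ∪ C) = -(f (γ ∪ C) - f (M \ γ ∪ C)) := by
  have e1 : f (S \ γ ∪ γ \ S ∪ C) = f (M \ γ ∪ C) := by
    refine eq_of_readOnly_inter_eq hf ?_
    ext x
    have h1 : x ∈ S → x ∈ M := fun h => hS h
    simp only [Finset.mem_inter, Finset.mem_union, Finset.mem_sdiff]
    tauto
  have e2 : f (M \ (S \ γ ∪ γ \ S) ∪ C) = f (γ ∪ C) := by
    refine eq_of_readOnly_inter_eq hf ?_
    ext x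
    have h1 : x ∈ S → x ∈ M := fun h => hS h
    have h2 : x ∈ γ → x ∈ M := fun h => hγ h
    simp only [Finset.mem_inter, Finset.mem_union, Finset.mem_sdiff]
    tauto
  rw [e1, e2]; ring

/-- Under the `S`-flip the antipodal difference of a function NOT READING `S` is unchanged. [folklore] -/
theorem hat_sflip_of_notRead {g : Finset (Sym2 V) → ℝ} {M C S γ : Finset (Sym2 V)} (hS : S ⊆ M) (hγ : γ ⊆ M)
    (hg : ∀ e ∈ S, ∀ A : Finset (Sym2 V), g (insert e A) = g A) :
    g (S \ γ ∪ γ \ S ∪ C) - g (M \ (S \ γ ∪ γ \ S) ∪ C) = g (γ ∪ C) - g (M \ γ ∪ C) := by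
  have e1 : g (S \ γ ∪ γ \ S ∪ C) = g (γ ∪ C) := by
    refine eq_of_notRead_sdiff_eq hg ?_
    ext x
    simp only [Finset.mem_sdiff, Finset.mem_union]
    tauto
  have e2 : g (M \ (S \ γ ∪ γ \ S) ∪ C) = g (M \ γ ∪ C) := by
    refine eq_of_notRead_sdiff_eq hg ?_
    ext x
    have h1 : x ∈ S → x ∈ M := fun h => hS h
    have h2 : x ∈ γ → x ∈ M := fun h => hγ h
    simp only [Finset.mem_sdiff, Finset.mem_union]
    tauto
  rw [e1, e2]

/-- **The elementary square is nonnegative on `f̂ĝ`.**  For `e ∈ S`, `e' ∉ S`, `f` increasing reading only `S` and `g` increasing not reading `S`: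
`f̂ĝ(γ) + f̂ĝ(γ+e+e') − f̂ĝ(γ+e) − f̂ĝ(γ+e') = (f̂(γ+e) − f̂(γ))·(ĝ(γ+e') − ĝ(γ)) ≥ 0`. [cite: Grimmett2006, §3.8 Thm. (3.90) (pp. 61–62)] -/
theorem square_hat_nonneg (M C S : Finset (Sym2 V)) (f g : Finset (Sym2 V) → ℝ) {e e' : Sym2 V} (he : e ∈ S) (he' : e' ∉ S)
    (hf : ∀ a : Sym2 V, a ∉ S → ∀ A : Finset (Sym2 V), f (insert a A) = f A)
    (hg : ∀ a ∈ S, ∀ A : Finset (Sym2 V), g (insert a A) = g A)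
    (hfm : ∀ ⦃A B : Finset (Sym2 V)⦄, A ⊆ B → f A ≤ f B) (hgm : ∀ ⦃A B : Finset (Sym2 V)⦄, A ⊆ B → g A ≤ g B)
    (γ : Finset (Sym2 V)) :
    0 ≤ (f (γ ∪ C) - f (M \ γ ∪ C)) * (g (γ ∪ C) - g (M \ γ ∪ C)) +
        (f (insert e (insert e' γ) ∪ C) - f (M \ insert e (insert e' γ) ∪ C)) *
          (g (insert e (insert e' γ) ∪ C) - g (M \ insert e (insert e' γ) ∪ C)) -
        (f (insert e γ ∪ C) - f (M \ insert e γ ∪ C)) * (g (insert e γ ∪ C) - g (M \ insert e γ ∪ C)) -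
        (f (insert e' γ ∪ C) - f (M \ insert e' γ ∪ C)) * (g (insert e' γ ∪ C) - g (M \ insert e' γ ∪ C)) := by
  have hne : e ≠ e' := fun h => he' (h ▸ he)
  by_cases heγ : e ∈ γ
  · rw [Finset.insert_eq_of_mem (Finset.mem_insert_of_mem heγ), Finset.insert_eq_of_mem heγ]
    linarith
  by_cases he'γ : e' ∈ γ
  · rw [Finset.insert_eq_of_mem he'γ]
    linarith
  -- the four corner values
  have f1 : f (insert e (insert e' γ) ∪ C) = f (insert e γ ∪ C) := by
    refine eq_of_readOnly_inter_eq hf ?_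
    ext x
    have h1 : x = e' → x ∉ S := fun h => h ▸ he'
    simp only [Finset.mem_inter, Finset.mem_union, Finset.mem_insert]
    tauto
  have f2 : f (M \ insert e (insert e' γ) ∪ C) = f (M \ insert e γ ∪ C) := by
    refine eq_of_readOnly_inter_eq hf ?_
    ext x
    have h1 : x = e' → x ∉ S := fun h => h ▸ he'
    simp only [Finset.mem_inter, Finset.mem_union, Finset.mem_insert, Finset.mem_sdiff]
    tauto
  have f3 : f (insert e' γ ∪ C) = f (γ ∪ C) := by
    refine eq_of_readOnly_inter_eq hf ?_
    ext x
    have h1 : x = e' → x ∉ S := fun h => h ▸ he'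
    simp only [Finset.mem_inter, Finset.mem_union, Finset.mem_insert]
    tauto
  have f4 : f (M \ insert e' γ ∪ C) = f (M \ γ ∪ C) := by
    refine eq_of_readOnly_inter_eq hf ?_
    ext x
    have h1 : x = e' → x ∉ S := fun h => h ▸ he'
    simp only [Finset.mem_inter, Finset.mem_union, Finset.mem_insert, Finset.mem_sdiff]
    tauto
  have g1 : g (insert e (insert e' γ) ∪ C) = g (insert e' γ ∪ C) := by
    refine eq_of_notRead_sdiff_eq hg ?_
    ext x
    have h1 : x = e → x ∈ S := fun h => h ▸ he
    simp only [Finset.mem_sdiff, Finset.mem_union, Finset.mem_insert]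
    tauto
  have g2 : g (M \ insert e (insert e' γ) ∪ C) = g (M \ insert e' γ ∪ C) := by
    refine eq_of_notRead_sdiff_eq hg ?_
    ext x
    have h1 : x = e → x ∈ S := fun h => h ▸ he
    simp only [Finset.mem_sdiff, Finset.mem_union, Finset.mem_insert]
    tauto
  have g3 : g (insert e γ ∪ C) = g (γ ∪ C) := by
    refine eq_of_notRead_sdiff_eq hg ?_
    ext x
    have h1 : x = e → x ∈ S := fun h => h ▸ he
    simp only [Finset.mem_sdiff, Finset.mem_union, Finset.mem_insert]
    tauto
  have g4 : g (M \ insert e γ ∪ C) = g (M \ γ ∪ C) := by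
    refine eq_of_notRead_sdiff_eq hg ?_
    ext x
    have h1 : x = e → x ∈ S := fun h => h ▸ he
    simp only [Finset.mem_sdiff, Finset.mem_union, Finset.mem_insert]
    tauto
  rw [f1, f2, f3, f4, g1, g2, g3, g4]
  -- monotone factors
  have hf_up : f (γ ∪ C) ≤ f (insert e γ ∪ C) :=
    hfm (Finset.union_subset_union (Finset.subset_insert e γ) le_rfl)
  have hf_dn : f (M \ insert e γ ∪ C) ≤ f (M \ γ ∪ C) :=
    hfm (Finset.union_subset_union (Finset.sdiff_subset_sdiff le_rfl (Finset.subset_insert e γ)) le_rfl)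
  have hg_up : g (γ ∪ C) ≤ g (insert e' γ ∪ C) :=
    hgm (Finset.union_subset_union (Finset.subset_insert e' γ) le_rfl)
  have hg_dn : g (M \ insert e' γ ∪ C) ≤ g (M \ γ ∪ C) :=
    hgm (Finset.union_subset_union (Finset.sdiff_subset_sdiff le_rfl (Finset.subset_insert e' γ)) le_rfl)
  have key : (f (γ ∪ C) - f (M \ γ ∪ C)) * (g (γ ∪ C) - g (M \ γ ∪ C)) +
        (f (insert e γ ∪ C) - f (M \ insert e γ ∪ C)) * (g (insert e' γ ∪ C) - g (M \ insert e' γ ∪ C)) -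
        (f (insert e γ ∪ C) - f (M \ insert e γ ∪ C)) * (g (γ ∪ C) - g (M \ γ ∪ C)) -
        (f (γ ∪ C) - f (M \ γ ∪ C)) * (g (insert e' γ ∪ C) - g (M \ insert e' γ ∪ C)) =
      ((f (insert e γ ∪ C) - f (M \ insert e γ ∪ C)) - (f (γ ∪ C) - f (M \ γ ∪ C))) *
        ((g (insert e' γ ∪ C) - g (M \ insert e' γ ∪ C)) - (g (γ ∪ C) - g (M \ γ ∪ C))) := by ring
  rw [key]
  exact mul_nonneg (by linarith) (by linarith)

/-- **Square certificates close `C_∞⁺`.**  If the doubly odd kernel `D_J(γ) = 1{ℓ(τγ) ≤ J} − 1{ℓ(γ) ≤ J}` (`τ` the `S`-flip) is a nonnegative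
combination of elementary squares `δ_γ + δ_{γ+e+e'} − δ_{γ+e} − δ_{γ+e'}` (`e ∈ S`, `e' ∈ M ∖ S`) — hypothesis `hcert`, in functional form — then the
levelwise antipodal inequality holds at level `J` for every increasing `f` reading only `S` and every increasing `g` not reading `S`.
[cite: Grimmett2006, §3.8 Thm. (3.90) (pp. 61–62); §3.9 (pp. 63–64)] [cite: Wagner2006, Thm. 5.8(d), §5.3] -/
theorem levels_le_of_squareCert (M C S : Finset (Sym2 V)) (hS : S ⊆ M) (J : ℕ)
    (c : Finset (Sym2 V) → Sym2 V → Sym2 V → ℝ) (hc : ∀ γ e e', 0 ≤ c γ e e')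
    (hcert : ∀ Φ : Finset (Sym2 V) → ℝ,
      ∑ γ ∈ M.powerset, ((if apExpC M C (S \ γ ∪ γ \ S) ≤ J then Φ γ else 0) - (if apExpC M C γ ≤ J then Φ γ else 0)) =
        ∑ γ ∈ M.powerset, ∑ e ∈ S, ∑ e' ∈ M \ S,
          c γ e e' * (Φ γ + Φ (insert e (insert e' γ)) - Φ (insert e γ) - Φ (insert e' γ)))
    (f g : Finset (Sym2 V) → ℝ)
    (hf : ∀ a : Sym2 V, a ∉ S → ∀ A : Finset (Sym2 V), f (insert a A) = f A)
    (hg : ∀ a ∈ S, ∀ A : Finset (Sym2 V), g (insert a A) = g A)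
    (hfm : ∀ ⦃A B : Finset (Sym2 V)⦄, A ⊆ B → f A ≤ f B) (hgm : ∀ ⦃A B : Finset (Sym2 V)⦄, A ⊆ B → g A ≤ g B) :
    ∑ γ ∈ M.powerset with apExpC M C γ ≤ J, (f (γ ∪ C) - f (M \ γ ∪ C)) * (g (γ ∪ C) - g (M \ γ ∪ C)) ≤ 0 := by
  set Φ : Finset (Sym2 V) → ℝ := fun γ => (f (γ ∪ C) - f (M \ γ ∪ C)) * (g (γ ∪ C) - g (M \ γ ∪ C)) with hΦ
  have key := hcert Φ
  -- the right-hand side is nonnegative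
  have hR : 0 ≤ ∑ γ ∈ M.powerset, ∑ e ∈ S, ∑ e' ∈ M \ S,
      c γ e e' * (Φ γ + Φ (insert e (insert e' γ)) - Φ (insert e γ) - Φ (insert e' γ)) := by
    refine Finset.sum_nonneg fun γ _ => Finset.sum_nonneg fun e he => Finset.sum_nonneg fun e' he' => ?_
    refine mul_nonneg (hc γ e e') ?_
    have := square_hat_nonneg M C S f g he (Finset.mem_sdiff.1 he').2 hf hg hfm hgm γ
    simpa only [hΦ] using this
  -- the flipped sum is minus the plain sum
  have hflip : ∑ γ ∈ M.powerset, (if apExpC M C (S \ γ ∪ γ \ S) ≤ J then Φ γ else 0) =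
      -∑ γ ∈ M.powerset, (if apExpC M C γ ≤ J then Φ γ else 0) := by
    rw [← Finset.sum_neg_distrib]
    refine Finset.sum_nbij' (fun γ => S \ γ ∪ γ \ S) (fun γ => S \ γ ∪ γ \ S) (fun γ hγ => ?_) (fun γ hγ => ?_)
      (fun γ hγ => ?_) (fun γ hγ => ?_) (fun γ hγ => ?_)
    · exact Finset.mem_powerset.2 (sflip_subset hS (Finset.mem_powerset.1 hγ))
    · exact Finset.mem_powerset.2 (sflip_subset hS (Finset.mem_powerset.1 hγ))
    · exact sflip_sflip hS (Finset.mem_powerset.1 hγ)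
    · exact sflip_sflip hS (Finset.mem_powerset.1 hγ)
    · have hγ' : γ ⊆ M := Finset.mem_powerset.1 hγ
      have hval : Φ (S \ γ ∪ γ \ S) = -Φ γ := by
        simp only [hΦ]
        rw [hat_sflip_of_readOnly (C := C) hS hγ' hf, hat_sflip_of_notRead (C := C) hS hγ' hg]
        ring
      split_ifs <;> simp [hval]
  have hL : ∑ γ ∈ M.powerset, ((if apExpC M C (S \ γ ∪ γ \ S) ≤ J then Φ γ else 0) - (if apExpC M C γ ≤ J then Φ γ else 0)) =
      -2 * ∑ γ ∈ M.powerset, (if apExpC M C γ ≤ J then Φ γ else 0) := by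
    rw [Finset.sum_sub_distrib, hflip]; ring
  rw [Finset.sum_filter]
  have : -2 * ∑ γ ∈ M.powerset, (if apExpC M C γ ≤ J then Φ γ else 0) ≥ 0 := by
    rw [← hL, key]; exact hR
  have h2 : ∑ γ ∈ M.powerset, (if apExpC M C γ ≤ J then Φ γ else 0) ≤ 0 := by linarith
  simpa only [hΦ] using h2

end FK

end Summit.CriticalPhenomena.PercolationContinuityZ3.Theorems

end
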